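import Literature.Claims.NS.Faliush2026
import HarnessLib

/-!
# CLAIM C176 `Solanki2026` — «THE NIKUL PROTOCOL: A Pure Mathematical Resolution to the 3D Navier-Stokes
Global Regularity via Time-Weighted Gevrey Quenching» (N. Solanki, preprint, Zenodo record 19633460, single
version, created 2026-04-17, 3 pp.; text of record = PDF «THE_NIKUL_PROTOCOL.pdf», sha16 09f47817023af2a6,
PDF page = printed page; cell ns-claims, D-0090, RULINGS v1.50 (1); QUICK row)

[claim: Solanki2026, status: disputed] — NOTHING in this file is asserted as a theorem of the tree except the
declarations explicitly marked PROVED (pure logic / tree facts). Every `def Step_… : Prop` is the AUTHOR'S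
assertion, typed as printed, with its locator.

WHAT THIS IS NOT: not a claim about NS regularity or blow-up; not a claim about any author beyond the
typed locator.

## Claimed statement (Theorem 1 (Global Smoothness) p.2 l.36–41)
«For any initial data u0 ∈ L²(R³), the Navier-Stokes solution u(x, t) remains strictly smooth for all
t ∈ [0, ∞).» Typed honestly over the print's referent «the Navier–Stokes solution» for an `L²` datum = EVERY
global Leray–Hopf weak solution from that datum, smooth for `t > 0` (a.e. equal to a classical solution on
`(0, ∞)`): `ClaimedTheorem` on the lattice domain the print's own Definition 1 fixes (`Σ_{k∈Z³}` = `𝕋³`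
Fourier modes — Δ1 recorded, not repaired), with the literal «R³» face `ClaimedTheoremR3` recorded alongside;
both Clay links PROVED (`clayB_of_claimedTheorem`, `clayA_of_claimedTheoremR3`, through the C141 `Faliush2026`
doors, whose `L²`-data Leray–Hopf faces these are, minus the divergence-free hypothesis the print omits).
The printed «[0, ∞)» (t = 0 included) face is recorded as `ClaimedTheorem_t0`: for a non-smooth `L²` datum it
is false trivially (records; not consumed by the chain).

## Deltas vs Clay (reference `ClayVariants.lean`; nearest (A) `clayR3.Regularity` / (B) `clayPeriodic.Regularity`)
Δ1 domain: «R³» in Thm 1 and App. A (3)–(4), but Def 1 (1) sums over `k ∈ Z³` (lattice = periodic) — typed on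
`𝕋³` modes for the Steps and the consumed face, «R³» face recorded. Δ2 equations: NO Navier–Stokes system is
printed; «B(u, u)» = «the bilinear interaction» (p.2 l.2–3) = «the non-linear advection term … F(u·∇u)(k)»
(p.2 l.56 – p.3 l.1) — typed as `u·∇u = Torus.convect u u` (no Leray projector is printed; none applied; App. A
(3) «≈ ∫ û(k−q) ⊗ û(q) dq» drops the factor `i q` of `F(u·∇u)` — recorded); `ν` appears only inside the weight
`e^{√(νt)|k|}`. Δ3 force: none (= unforced). Δ4 data: «any initial data u0 ∈ L²» — no divergence-free, no
smoothness: FAR WIDER than (4)/(8); claim STRONGER than (A)/(B) on the data axis. Δ5 conclusion: «strictly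
smooth for all t ∈ [0, ∞)», no energy/pressure/uniqueness clause. Δ7 parameters: `C`, `C_geom`, `C_young`
«universal»; `T* ≈ (C·M)⁻⁴`.

## ORDERED STEP INDEX (dependency order of the printed argument: Def 1 → Lemma 1 → Remark 1 → Thm 1)
 1. `Step_L1`   — Lemma 1 (Bilinear Quenching) display (2) p.2 l.4–22 = App. A (5) p.3 l.28–34: ONE universal
                  `C` with `‖B(u,u)‖_{G_R} ≤ C√t ‖u‖²_{G_R}` — `B = u·∇u`, `G_R` = Def 1 (1) on `ℤ³` modes, typed
                  for `t > 0` (the degenerate instant `t = 0` deliberately excluded) and smooth divergence-free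
                  fields with finite `G_R(t)`-norm. CANDIDATE FALSE LEMMA (quadratic first-order `B` vs a GAIN `√t`).
 2. `Step_R1`   — Remark 1 p.2 l.23–34 + proof sentence p.2 l.46 «The norm ‖u(t)‖_{G_R} cannot diverge», as the
                  implication the prose uses: `Step_L1 → NormStaysFinite`. (`Composes`-pattern, C21.)
 3. `Step_T1`   — proof of Thm 1 p.2 l.46–48 («Since the vorticity remains bounded in the Gevrey space, the
                  solution is globally extended …») with Def 1's BKM sentence p.1 l.32–35:
                  `NormStaysFinite → ClaimedTheorem`.
 4. `claim_of_steps : Step_L1 → Step_R1 → Step_T1 → ClaimedTheorem` — PROVED (every binder consumed).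
 5. Clay links PROVED: `clayB_of_claimedTheorem`, `clayA_of_claimedTheoremR3`.
-/

open Set MeasureTheory Filter Topology

namespace Literature.Claims.NS.Solanki2026

open Literature.Analysis Literature.Analysis.FluidPDE Literature.Analysis.FunctionSpaces
  Literature.Claims.NS.ClayVariants
open Literature.Claims.NS.Faliush2026 (T3 E3 Z3 coeff)

noncomputable section

/-! ## §A Vocabulary: Definition 1 and the bilinear term -/

/-- The Euclidean length `|k|` of a frequency `k ∈ ℤ³`. [cite: Solanki2026, Def 1 (1) p.1 l.23–31] -/
def freqNorm (k : Z3) : ℝ := Real.sqrt (Torus.freqNormSq k)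

/-- Definition 1's weight `e^{√(νt)|k|}` ((1) p.1; radius of analyticity `δ = √(νt)`, p.1 l.32–34).
[cite: Solanki2026, Def 1 (1) p.1 l.23–34] -/
def gevreyWeight (ν t : ℝ) (k : Z3) : ℝ := Real.exp (Real.sqrt (ν * t) * freqNorm k)

/-- The summand of Definition 1's norm, `|û(k)| e^{√(νt)|k|}` (Fourier coefficients of the complexified
field, tree convention `Faliush2026.coeff`). [cite: Solanki2026, Def 1 (1) p.1 l.23–31] -/
def gevreyTerm (ν t : ℝ) (v : T3 → E3) (k : Z3) : ℝ := ‖coeff v k‖ * gevreyWeight ν t k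

/-- **Definition 1 (Time-Weighted Ramanujan-Gevrey Space) (1) p.1 l.23–31**: «‖u(t)‖_{G_R} = Σ_{k∈Z³} |û(k, t)|
e^{√(νt)|k|}» — the `ℓ¹`-Gevrey norm of a field on `𝕋³` at time-parameter `t` (unconditional sum; junk `0`
when not summable — the Steps carry the summability hypothesis «‖u(t)‖_{G_R} < ∞» explicitly).
[cite: Solanki2026, Def 1 (1) p.1 l.23–31] -/
def GR (ν t : ℝ) (v : T3 → E3) : ℝ := ∑' k : Z3, gevreyTerm ν t v k

/-- «‖u(t)‖_{G_R} < ∞» (p.1 l.34): the series (1) converges. [cite: Solanki2026, Def 1 p.1 l.32–35] -/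
def FiniteGR (ν t : ℝ) (v : T3 → E3) : Prop := Summable (gevreyTerm ν t v)

/-- The print's `B(u, u)` = «the bilinear interaction» (p.2 l.2–3) = «the non-linear advection term …
F(u·∇u)(k)» (p.2 l.56 – p.3 l.2): the field `(u·∇)u` (tree `Torus.convect u u`; no Leray projector printed,
none applied; App. A (3) «F(B(u,u))(k) ≈ ∫ û(k−q) ⊗ û(q) dq» is the author's approximate Fourier description).
[cite: Solanki2026, Lemma 1 p.2 l.1–3; App. A (3) p.2 l.54 – p.3 l.6] -/
def B (v : T3 → E3) : T3 → E3 := Torus.convect v v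

/-! ## §B The claimed statement -/

/-- **CLAIMED THEOREM = Theorem 1 (Global Smoothness) p.2 l.36–41**, consumed face: «For any initial data
u0 ∈ L²(R³), the Navier-Stokes solution u(x, t) remains strictly smooth for all t ∈ [0, ∞)» — for every `ν > 0`,
every `L²` datum on the lattice domain of Def 1 (`𝕋³`; NO divergence-free hypothesis, as printed) and EVERY
global Leray–Hopf weak solution `u` from it, `u` is for `t > 0` a.e. equal to a classical solution on
`(0, ∞) × 𝕋³` (the shape of C141 `Faliush2026.ClaimedTheoremT3` without its divergence-free hypothesis).
[claim: Solanki2026, status: disputed] [cite: Solanki2026, Thm 1 p.2 l.36–41; Def 1 (1) p.1 l.23–31] -/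
def ClaimedTheorem : Prop :=
  ∀ ν : ℝ, 0 < ν → ∀ u₀ : T3 → E3, MemLp u₀ 2 volume →
    ∀ u : ℝ → T3 → E3, Torus.IsGlobalLerayHopf ν 0 u₀ u →
      ∃ (U : ℝ → T3 → E3) (P : ℝ → T3 → ℝ),
        Torus.IsClassicalNSSolutionOn (Ioi 0) ν 0 U P ∧ ∀ t : ℝ, 0 < t → U t =ᵐ[volume] u t

/-- **The literal «R³» face of Theorem 1** (recorded; Δ1): the same over the tree's whole-space Leray–Hopf and
classical classes (shape of `Faliush2026.ClaimedTheoremR3`, divergence-free hypothesis dropped as printed).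
[claim: Solanki2026, status: disputed] [cite: Solanki2026, Thm 1 p.2 l.36–41] -/
def ClaimedTheoremR3 : Prop :=
  ∀ ν : ℝ, 0 < ν → ∀ u₀ : E3 → E3, MemLp u₀ 2 volume →
    ∀ u : ℝ → E3 → E3, Literature.Analysis.FluidPDE.IsGlobalLerayHopf ν 0 u₀ u →
      ∃ (U : ℝ → E3 → E3) (P : ℝ → E3 → ℝ),
        Literature.Analysis.FluidPDE.IsClassicalNSSolutionOn (Ioi 0) ν 0 U P ∧
          ∀ t : ℝ, 0 < t → U t =ᵐ[volume] u t

/-- **The printed «t ∈ [0, ∞)» face** (t = 0 included; recorded, NOT consumed): a classical solution on the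
CLOSED half-line `[0, ∞)` through the datum itself — for a non-smooth `L²` datum false trivially (`U 0` is
smooth). [claim: Solanki2026, status: disputed] [cite: Solanki2026, Thm 1 p.2 l.36–41] -/
def ClaimedTheorem_t0 : Prop :=
  ∀ ν : ℝ, 0 < ν → ∀ u₀ : T3 → E3, MemLp u₀ 2 volume →
    ∀ u : ℝ → T3 → E3, Torus.IsGlobalLerayHopf ν 0 u₀ u →
      ∃ (U : ℝ → T3 → E3) (P : ℝ → T3 → ℝ),
        Torus.IsClassicalNSSolutionOn (Ici 0) ν 0 U P ∧ U 0 = u₀ ∧ ∀ t : ℝ, 0 < t → U t =ᵐ[volume] u t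

/-- «The norm ‖u(t)‖_{G_R} cannot diverge» (proof of Thm 1 p.2 l.46; Remark 1 p.2 l.31–34 «forcing the system
into a permanent small-data analytic regime»), read at each positive time: along every global Leray–Hopf
solution from an `L²` datum, `‖u(t)‖_{G_R(t)} < ∞` for every `t > 0`.
[claim: Solanki2026, status: disputed] [cite: Solanki2026, proof of Thm 1 p.2 l.42–48; Remark 1 p.2 l.23–34] -/
def NormStaysFinite : Prop :=
  ∀ ν : ℝ, 0 < ν → ∀ u₀ : T3 → E3, MemLp u₀ 2 volume →
    ∀ u : ℝ → T3 → E3, Torus.IsGlobalLerayHopf ν 0 u₀ u → ∀ t : ℝ, 0 < t → FiniteGR ν t (u t)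

/-! ## §C The Steps of the printed argument -/

/-- **Step 1 — Lemma 1 (Bilinear Quenching), display (2) p.2 l.4–22** (= App. A (5) p.3 l.28–34): «In the
Gevrey Banach algebra, the non-linear operator satisfies the strict inequality: ‖B(u, u)‖_{G_R} ≤ C √t ‖u‖²_{G_R}
(2) where C is a universal geometric constant independent of the initial data» — ONE `C` (before `ν`, «arises
strictly from the Lebesgue measure of R³, … and π», p.3 l.35–39), for every `ν > 0`, every `t > 0` (the
instant `t = 0`, where the right side vanishes, is deliberately NOT typed — DEGENERATE-WITNESS hygiene; the
print fixes no range for `t`), and every smooth divergence-free field on `𝕋³` with `‖u‖_{G_R(t)} < ∞` (the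
algebra's members): `‖(u·∇)u‖_{G_R(t)} ≤ C √t ‖u‖²_{G_R(t)}`. Printed support: App. A (3)–(5) (sub-additive
weight + Young `ℓ¹ ∗ ℓ¹`; no displayed step produces the factor `√t`).
[claim: Solanki2026, status: disputed] [cite: Solanki2026, Lemma 1 (2) p.2 l.4–22; App. A (3)–(5) p.2 l.54 – p.3 l.39] -/
def Step_L1 : Prop :=
  ∃ C : ℝ, ∀ ν : ℝ, 0 < ν → ∀ t : ℝ, 0 < t → ∀ v : T3 → E3,
    Torus.IsSmooth v → Torus.IsDivFree v → FiniteGR ν t v →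
      GR ν t (B v) ≤ C * Real.sqrt t * GR ν t v ^ 2

/-- **Step 2 — Remark 1 (The Survival Time T*) p.2 l.23–34 with the proof sentence p.2 l.44–46** («Within this
strict non-zero temporal window [0, T*], the viscous weight √t algebraically overpowers the bounded geometric
constant C. This strictly quenches the non-linear stretching, forcing the system into a permanent small-data
analytic regime …»; «Because the absolute constant C is independent of the initial data, the "Smoothing Effect"
strictly quenches the bilinear operator. The norm ‖u(t)‖_{G_R} cannot diverge»), typed as the implication the
prose uses: (2) ⇒ the `G_R`-norm of every Leray–Hopf solution from an `L²` datum is finite at every `t > 0`.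
No inequality linking `‖u(t)‖_{G_R}` to `‖u₀‖_{L²}` is printed (`Composes`-pattern of C21).
[claim: Solanki2026, status: disputed] [cite: Solanki2026, Remark 1 p.2 l.23–34; proof of Thm 1 p.2 l.44–46] -/
def Step_R1 : Prop := Step_L1 → NormStaysFinite

/-- **Step 3 — the closing sentences of the proof of Thm 1 p.2 l.46–48** («Since the vorticity remains bounded in
the Gevrey space, the solution is globally extended beyond T_sing, algebraically precluding the existence of a
singularity») with Definition 1's sentence p.1 l.32–35 («If ‖u(t)‖_{G_R} < ∞, the solution is analytic and no
singularity can exist according to the Beale-Kato-Majda (BKM) criterion»), typed as the implication used: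
finite `G_R`-norm at every `t > 0` ⇒ Theorem 1 (consumed face).
[claim: Solanki2026, status: disputed] [cite: Solanki2026, proof of Thm 1 p.2 l.46–48; Def 1 p.1 l.32–35] -/
def Step_T1 : Prop := NormStaysFinite → ClaimedTheorem

/-! ## §D Composition (PROVED, pure logic) and Clay links (PROVED, tree doors) -/

/-- **COMPOSITION (PROVED)** — the printed chain Def 1 → Lemma 1 (2) → Remark 1 → Thm 1: every binder
consumed. [cite: Solanki2026, proof of Thm 1 p.2 l.42–48] -/
theorem claim_of_steps (hL1 : Step_L1) (hR1 : Step_R1) (hT1 : Step_T1) : ClaimedTheorem :=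
  hT1 (hR1 hL1)

/-- The consumed face implies C141's `𝕋³` face (which additionally assumes a weakly divergence-free datum).
[cite: Solanki2026, Thm 1 p.2 l.36–41] -/
theorem faliushT3_of_claimedTheorem (h : ClaimedTheorem) : Faliush2026.ClaimedTheoremT3 :=
  fun ν hν u₀ hu₀ _ u hu => h ν hν u₀ hu₀ u hu

/-- **CLAY LINK (PROVED)**: the consumed face settles Clay (B) (`clayPeriodic.Regularity`, Fefferman (8)/(10)/(11))
through C141's door `Faliush2026.clayB_of_claimedT3` (Hopf existence + weak–strong uniqueness + the Serrin `L∞`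
door). [cite: FeffermanClay2006, (B) p. 2] [cite: Solanki2026, Thm 1 p.2 l.36–41] -/
theorem clayB_of_claimedTheorem (h : ClaimedTheorem) : clayPeriodic.Regularity :=
  Faliush2026.clayB_of_claimedT3 (faliushT3_of_claimedTheorem h)

/-- The literal «R³» face implies C141's `ℝ³` face. [cite: Solanki2026, Thm 1 p.2 l.36–41] -/
theorem faliushR3_of_claimedTheoremR3 (h : ClaimedTheoremR3) : Faliush2026.ClaimedTheoremR3 :=
  fun ν hν u₀ hu₀ _ u hu => h ν hν u₀ hu₀ u hu

/-- **CLAY LINK (PROVED), «R³» face**: Clay (A) (`clayR3.Regularity`) through C141's door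
`Faliush2026.clayA_of_claimedR3`. [cite: FeffermanClay2006, (A) p. 2] [cite: Solanki2026, Thm 1 p.2 l.36–41] -/
theorem clayA_of_claimedTheoremR3 (h : ClaimedTheoremR3) : clayR3.Regularity :=
  Faliush2026.clayA_of_claimedR3 (faliushR3_of_claimedTheoremR3 h)

/-- With the Steps, the printed chain would settle Clay (B). [cite: Solanki2026, §4 p.2 l.49–53] [cite: FeffermanClay2006, (B) p. 2] -/
theorem clayB_of_steps (hL1 : Step_L1) (hR1 : Step_R1) (hT1 : Step_T1) : clayPeriodic.Regularity :=
  clayB_of_claimedTheorem (claim_of_steps hL1 hR1 hT1)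

end

end Literature.Claims.NS.Solanki2026
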